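import Literature.NumberTheory.GelbartRogawski1991.DoubledWeilRepresentationAssembly
import Literature.NumberTheory.GelbartRogawski1991.DoubledWeilRepresentationFiniteHalf
import Literature.NumberTheory.GelbartRogawski1991.DoubledWeilRepresentationRationalParabolic
import Literature.NumberTheory.GelbartRogawski1991.DoubledWeilRepresentationUndoubling
import HarnessLib

-- buildfix G11b-3 recipe (LEDGER B13-1/B13-3): elaborate sequentially so the trailing `attribute [implicit_reducible]`
-- block (reducibilityCoreExt is keyed to the async environment branch) is in force at `.olean` export.
set_option Elab.async false

/-!
# [GelbartRogawski1991, Prop. 3.1.1] for the CM dual-pair datum, from the per-place package and the archimedean half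

Composition of the doubling construction (`DoubledUnitaryGlobalSplittingData` and its siblings): for the datum of
record `cmSplittingDatum L e dV hdV hdV0 dW hdW hdW0` (`UnitaryDualPairThetaKernelCM`; `𝕍 = V ⊗_L W` with diagonal
Gram matrices over the CM field `L`), `SplittingDatum.CompatibleSplitting` — the body of [GelbartRogawski1991,
§3.1 Prop. 3.1.1 p. 455 L1–2] for `G = U(𝕍)`, `Mp := adelicMpCont`, `i := r_F` — FOLLOWS from
(i) a doubled Weil representation for SOME Hecke character (`compatibleSplitting_of_isDoubledWeilRep`:
S4 ∘ S3′ ∘ S3 ∘ S2, and `g ↦ g ⊕ 1` carries `G₁(L⁺)` into `H(L⁺)`, `inlG_rational`), hence from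
(ii) a per-place package `FinLocalFamily χ 𝔪` and an archimedean half `IsArchHalf χ sa` for one unitary Hecke
character `χ` of `L` with `χ|_{𝕀_{L⁺}} = ε_{L/L⁺}` (`gru_body_of`; such `χ` exist: tree
`exists_isUnitary_isSplittingChar_one`).  `gru_shape_of` restates the conclusion in the exact quantifier shape of
the consumer's hypothesis binder.  The two inputs are supplied by `LocalDoubledUnitary*` (finite places) and the
archimedean Weil representation of `U(n,n)`; nothing is asserted here.
-/

set_option autoImplicit false

noncomputable section

open scoped Classical
open scoped Matrix Kronecker TensorProduct
open NumberField IsDedekindDomain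
open Literature.RepresentationTheory.HeisenbergGroup
open Literature.NumberTheory.Automorphic
open Literature.NumberTheory.Weil1964
open Literature.RepresentationTheory.HarrisKudlaSweet1996
open Literature.NumberTheory.GaloisRepresentations

namespace Literature.NumberTheory.GelbartRogawski1991.GRConstruction

open UnitaryDualPair

variable (L : Type) [Field L] [NumberField L] [IsCMField L]

variable {N M n : ℕ} (e : Fin N × Fin M ≃ Fin n)
  (dV : Fin N → L) (hdV : ∀ i, IsCMField.complexConj L (dV i) = dV i) (hdV0 : ∀ i, dV i ≠ 0)
  (dW : Fin M → L) (hdW : ∀ i, IsCMField.complexConj L (dW i) = dW i) (hdW0 : ∀ i, dW i ≠ 0)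

/-- the doubled hermitian form over `L` is the re-enumerated block form `J ⊕ (−J)`.
[cite: GelbartRogawski1991, §3.1 Prop. 3.1.1 p. 455 L1–2] -/
theorem hermD_eq :
    hermD L e dV hdV dW hdW =
      Matrix.reindex (e₂ (n := n)) (e₂ (n := n))
        (Matrix.fromBlocks (Matrix.reindex e e (Matrix.diagonal dV ⊗ₖ Matrix.diagonal dW)) 0 0
          (-Matrix.reindex e e (Matrix.diagonal dV ⊗ₖ Matrix.diagonal dW))) := by
  have hP : Matrix.diagonal dV ⊗ₖ Matrix.diagonal dW =
      (realDiagonal L dV hdV ⊗ₖ realDiagonal L dW hdW).map (algebraMap (Fp L) L) := by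
    rw [← UnitaryGroup.kronecker_map_map, realDiagonal_map, realDiagonal_map]
  set f : Fp L → L := ⇑(algebraMap (Fp L) L) with hf
  have hf0 : f 0 = 0 := by simp [hf]
  have hfn : ∀ a, f (-a) = -f a := fun a => by simp [hf]
  unfold hermD gramD gramR
  rw [hP, ← hf]
  simp only [Matrix.reindex_apply, ← Matrix.submatrix_map, Matrix.fromBlocks_map, Matrix.map_zero f hf0,
    Matrix.map_neg f hfn]

/-- the RATIONAL-level `g ↦ g ⊕ 1`: `G₁(L⁺) →* H(L⁺)` (tree `reindexU`, `blockDiag`, cast along `hermD_eq`).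
[cite: GelbartRogawski1991, §3.1 Prop. 3.1.1 p. 455 L1–2] -/
def inlGRat : UnitaryGroup.rationalPair (Fp L) L (IsCMField.complexConj L) N M (Matrix.diagonal dV) (Matrix.diagonal dW) →*
    UnitaryGroup.rational (Fp L) L (IsCMField.complexConj L) (n + n) (hermD L e dV hdV dW hdW) :=
  (Subgroup.inclusion (le_of_eq (congrArg (unitaryGroupOfForm ((IsCMField.complexConj L : L ≃ₐ[Fp L] L) : L →+* L))
      (hermD_eq L e dV hdV dW hdW).symm))).comp <|
    (UnitaryGroup.reindexU _ (e₂ (n := n)) _).comp <|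
      (UnitaryGroup.blockDiag _ _ _).comp <|
        (MonoidHom.prod ((UnitaryGroup.reindexU _ e _)) 1)

/-- **`g ↦ g ⊕ 1` carries `G₁(L⁺)` into `H(L⁺)`**: `inlG (γ ⊗ 1) = (inlGRat γ) ⊗ 1`.
[cite: GelbartRogawski1991, §3.1 Prop. 3.1.1 p. 455 L1–2] -/
theorem inlG_rationalPairToAdelic (γ : UnitaryGroup.rationalPair (Fp L) L (IsCMField.complexConj L) N M
      (Matrix.diagonal dV) (Matrix.diagonal dW)) :
    inlG L e dV hdV dW hdW (UnitaryGroup.rationalPairToAdelic (Fp L) L (IsCMField.complexConj L) N M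
        (Matrix.diagonal dV) (Matrix.diagonal dW) γ) =
      UnitaryGroup.toAdelic (Fp L) L (IsCMField.complexConj L) (n + n) (hermD L e dV hdV dW hdW)
        (inlGRat L e dV hdV dW hdW γ) := by
  apply Subtype.ext
  apply Units.ext
  set A := ((γ : GL (Fin N × Fin M) L) : Matrix (Fin N × Fin M) (Fin N × Fin M) L) with hA
  set φ := algebraMap L (AdeleRing (𝓞 L) L) with hφ
  change Matrix.reindex (e₂ (n := n)) (e₂ (n := n)) (Matrix.fromBlocks (Matrix.reindex e e (A.map φ)) 0 0 1) =
    (Matrix.reindex (e₂ (n := n)) (e₂ (n := n)) (Matrix.fromBlocks (Matrix.reindex e e A) 0 0 1)).map φ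
  simp only [Matrix.reindex_apply, ← Matrix.submatrix_map, Matrix.fromBlocks_map,
    Matrix.map_zero _ (map_zero φ), Matrix.map_one _ (map_zero φ) (map_one φ)]

/-- `g ↦ g ⊕ 1` carries `G₁(L⁺)` into `H(L⁺)`. [cite: GelbartRogawski1991, §3.1 Prop. 3.1.1 p. 455 L1–2] -/
theorem inlG_rational :
    ∀ γ ∈ (UnitaryGroup.rationalPairToAdelic (Fp L) L (IsCMField.complexConj L) N M
        (Matrix.diagonal dV) (Matrix.diagonal dW)).range, inlG L e dV hdV dW hdW γ ∈ ratH L e dV hdV dW hdW := by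
  rintro _ ⟨γ, rfl⟩
  exact ⟨inlGRat L e dV hdV dW hdW γ, (inlG_rationalPairToAdelic L e dV hdV dW hdW γ).symm⟩


/-! ## The composition -/

/-- a per-place family gives a finite half (restatement of `S1fin_asm` from a `Nonempty` hypothesis).
[cite: GelbartRogawski1991, §3.1 Prop. 3.1.1 p. 455 L1–2] -/
theorem S1fin_of_family (χ : HeckeCharacter L) (𝔪 : ∀ v, PlaceMeasure L v)
    (h𝓕 : Nonempty (FinLocalFamily L e dV hdV hdV0 dW hdW hdW0 χ 𝔪)) :
    ∃ sf, IsFinHalf L e dV hdV hdV0 dW hdW hdW0 χ sf :=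
  h𝓕.elim fun 𝓕 => S1fin_asm L e dV hdV hdV0 dW hdW hdW0 χ 𝔪 𝓕

/-- **S1**: a per-place family and an archimedean half give a doubled Weil representation.
[cite: GelbartRogawski1991, §3.1 Prop. 3.1.1 p. 455 L1–2] -/
theorem isDoubledWeilRep_of_family_of_archHalf (χ : HeckeCharacter L) (𝔪 : ∀ v, PlaceMeasure L v)
    (h𝓕 : Nonempty (FinLocalFamily L e dV hdV hdV0 dW hdW hdW0 χ 𝔪))
    (ha : ∃ sa, IsArchHalf L e dV hdV hdV0 dW hdW hdW0 χ sa) :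
    ∃ sD : HA L e dV hdV dW hdW →* MpD L e dV hdV dW hdW, IsDoubledWeilRep L e dV hdV hdV0 dW hdW hdW0 χ sD :=
  (S1fin_of_family L e dV hdV hdV0 dW hdW hdW0 χ 𝔪 h𝓕).elim fun _ hf =>
    ha.elim fun _ ha' => isDoubledWeilRep_of_halves L e dV hdV hdV0 dW hdW hdW0 χ hf ha'

/-- **S2 + S3 + S3′ + S4**: a doubled Weil representation (for ANY Hecke character) yields the compatible splitting of
the datum of record. [cite: GelbartRogawski1991, §3.1 Prop. 3.1.1 p. 455 L1–2] -/
theorem compatibleSplitting_of_isDoubledWeilRep (χ : HeckeCharacter L) {sD : HA L e dV hdV dW hdW →* MpD L e dV hdV dW hdW}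
    (hs : IsDoubledWeilRep L e dV hdV hdV0 dW hdW hdW0 χ sD) : (D L e dV hdV hdV0 dW hdW hdW0).CompatibleSplitting :=
  S4_undouble L e dV hdV hdV0 dW hdW hdW0 hs.continuous hs.proj_eq fun γ hγ =>
    S3'_propagate L e dV hdV hdV0 dW hdW hdW0 χ hs (S3_parabolic_rational L e dV hdV hdV0 dW hdW hdW0 χ hs)
      (S2_ratH_normalClosure_siegel L e dV hdV hdV0 dW hdW hdW0) _ (inlG_rational L e dV hdV dW hdW γ hγ)

/-- **[GelbartRogawski1991, Prop. 3.1.1] at the CM dual-pair datum, from the two analytic inputs**: if for every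
unitary Hecke character `χ` of `L` with `χ|_{𝕀_{L⁺}} = ε_{L/L⁺}` and every choice of Haar data there is a per-place
family, and an archimedean half, then `(cmSplittingDatum …).CompatibleSplitting`.
[cite: GelbartRogawski1991, §3.1 Prop. 3.1.1 p. 455 L1–2] -/
theorem gru_body_of
    (hfin : ∀ χ : HeckeCharacter L, χ.IsUnitary → IsSplittingChar L 1 χ → ∀ 𝔪 : ∀ v, PlaceMeasure L v,
      Nonempty (FinLocalFamily L e dV hdV hdV0 dW hdW hdW0 χ 𝔪))
    (harch : ∀ χ : HeckeCharacter L, χ.IsUnitary → IsSplittingChar L 1 χ →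
      ∃ sa, IsArchHalf L e dV hdV hdV0 dW hdW hdW0 χ sa) :
    (D L e dV hdV hdV0 dW hdW hdW0).CompatibleSplitting :=
  let 𝔪 : ∀ v, PlaceMeasure L v := fun v => Classical.choice (nonempty_placeMeasure L v)
  (exists_isUnitary_isSplittingChar_one (L := L)).elim fun χ hχ =>
    (isDoubledWeilRep_of_family_of_archHalf L e dV hdV hdV0 dW hdW hdW0 χ 𝔪 (hfin χ hχ.1 hχ.2 𝔪)
        (harch χ hχ.1 hχ.2)).elim fun _ hs =>
      compatibleSplitting_of_isDoubledWeilRep L e dV hdV hdV0 dW hdW hdW0 χ hs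

/-- the same in the EXACT quantifier shape of the consumer's binder (`∀ L … e dV hdV hdV0 dW hdW hdW0,
(cmSplittingDatum L e dV hdV hdV0 dW hdW hdW0).CompatibleSplitting`), from the two inputs at every datum.
[cite: GelbartRogawski1991, §3.1 Prop. 3.1.1 p. 455 L1–2] -/
theorem gru_shape_of
    (hfin : ∀ (L : Type) [Field L] [NumberField L] [IsCMField L] {N M n : ℕ} (e : Fin N × Fin M ≃ Fin n)
      (dV : Fin N → L) (hdV : ∀ i, IsCMField.complexConj L (dV i) = dV i) (hdV0 : ∀ i, dV i ≠ 0)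
      (dW : Fin M → L) (hdW : ∀ i, IsCMField.complexConj L (dW i) = dW i) (hdW0 : ∀ i, dW i ≠ 0)
      (χ : HeckeCharacter L), χ.IsUnitary → IsSplittingChar L 1 χ → ∀ 𝔪 : ∀ v, PlaceMeasure L v,
      Nonempty (FinLocalFamily L e dV hdV hdV0 dW hdW hdW0 χ 𝔪))
    (harch : ∀ (L : Type) [Field L] [NumberField L] [IsCMField L] {N M n : ℕ} (e : Fin N × Fin M ≃ Fin n)
      (dV : Fin N → L) (hdV : ∀ i, IsCMField.complexConj L (dV i) = dV i) (hdV0 : ∀ i, dV i ≠ 0)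
      (dW : Fin M → L) (hdW : ∀ i, IsCMField.complexConj L (dW i) = dW i) (hdW0 : ∀ i, dW i ≠ 0)
      (χ : HeckeCharacter L), χ.IsUnitary → IsSplittingChar L 1 χ →
      ∃ sa, IsArchHalf L e dV hdV hdV0 dW hdW hdW0 χ sa) :
    ∀ (L : Type) [Field L] [NumberField L] [IsCMField L] {N M n : ℕ} (e : Fin N × Fin M ≃ Fin n)
      (dV : Fin N → L) (hdV : ∀ i, IsCMField.complexConj L (dV i) = dV i) (hdV0 : ∀ i, dV i ≠ 0)
      (dW : Fin M → L) (hdW : ∀ i, IsCMField.complexConj L (dW i) = dW i) (hdW0 : ∀ i, dW i ≠ 0),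
      (cmSplittingDatum L e dV hdV hdV0 dW hdW hdW0).CompatibleSplitting :=
  fun L _ _ _ _ _ _ e dV hdV hdV0 dW hdW hdW0 =>
    gru_body_of L e dV hdV hdV0 dW hdW hdW0 (hfin L e dV hdV hdV0 dW hdW hdW0) (harch L e dV hdV hdV0 dW hdW hdW0)


/-! ### Build-lane note (ops-buildfix G11b-3 recipe, LEDGER B13-1, 2026-08-21)
`lean -o` (the hub build lane, never `lean`/the gate check) runs Lean 4.32's library-suggestion indexers
(`Lean.LibrarySuggestions.SymbolFrequency` / `SineQuaNon`, from their `exportEntriesFn`) over the statement of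
every local theorem that is not a denied premise; on this family's statements (very large dependent binder
telescopes through the theta-kernel / dual-pair data) that fold runs for tens of minutes to hours and the build
lane kills the job (incident G11b-3, run/shared/lean/ops/buildfix/G11b-3-DOSSIER.md). `isDeniedPremise` skips
`[implicit_reducible]` constants before any fold, and a reducibility status on a *theorem* is inert (Meta never
unfolds `thmInfo`; the kernel ignores the attribute), so the public theorems of this file are tagged
`[implicit_reducible]` purely to keep them out of that index. Only other effect: they are not offered by
`+suggestions` premise selectors. No statement or proof is changed; superseded if the operator lands a
deny-list form (`HarnessLib.PremiseIndex`). -/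
set_option allowUnsafeReducibility true in
attribute [implicit_reducible]
  hermD_eq inlG_rationalPairToAdelic inlG_rational S1fin_of_family
  isDoubledWeilRep_of_family_of_archHalf compatibleSplitting_of_isDoubledWeilRep gru_body_of
  gru_shape_of

end Literature.NumberTheory.GelbartRogawski1991.GRConstruction
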